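import Literature.AlgebraicGeometry.Motives.SeesawChartTrivialised
import Literature.RingTheory.Ideal.SeesawLocalDatum
import HarnessLib

/-!
# The seesaw closed subscheme, chart step: the chart theorem `Triv B ↔ (I + I′)·B = 0` over `A_f`

[MumfordAV1970] §10 (p. 89) / [GortzWedhorn2023] Thm. 24.66 on ONE chart `(U, f)` of `W`, in the vocabulary of
`SeesawChartSections` / `SeesawChartTrivialised`:
* §1 (T-H1′), dual side — `exists_dualSec_linearEquiv_of_triv`: a trivialised `B` has
  `Hom(𝓕_{B_g}|_⊤, 𝒪|_⊤) ≃ₗ[B_g] B_g` near every maximal ideal;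
* §2 the chart assembly over the chart ring `A_f = Localization.Away f`: `compAlgebra` (an `A_f`-algebra as a
  `Γ(W, U)`-algebra), the local seesaw datum `chartDatumAway` (★ `Literature.RingTheory.LocalSeesaw.LocalSeesawDatum`
  fed by (T-H1′), (T-H1′)-dual and (T-H2′)), and **`triv_iff_chartAway`**: if `H⁰(𝓕)` and `Hom(𝓕, 𝒪)` are represented
  on `D(f)` by `Ann(I)`, `Ann(I′)` (`H0ReprChart`, `DualReprChart`), then for EVERY `A_f`-algebra `B`,
  `𝓕_B` is trivialised from the base iff `(I + I′)·B = 0` (hypothesis: the base-change identity `brickN`).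
(Cell `hodgecm-mathlib`, M13 node N1, file S5b of the split plan; HOME certificate `B-plan/m13-glue/N1-Assembly.v9.B-p01g12.lean`
164baf9abb46c288 PART II §9–§10 — decls token-identical except that the v9 hypotheses `brickA`/`brickB` are gone.)

## References
* [MumfordAV1970] D. Mumford, *Abelian Varieties* (1970), §10 p. 89.
* [GortzWedhorn2023] U. Görtz, T. Wedhorn, *Algebraic Geometry II* (2023), Thm. 24.66 (p. 405; proof pp. 407–408).
-/

set_option autoImplicit false

noncomputable section

-- `TopCat.Presheaf`/`Scheme.Modules` are not reducible (as in Mathlib's `AlgebraicGeometry/Modules`).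
set_option backward.isDefEq.respectTransparency false

universe u

open CategoryTheory CategoryTheory.Limits AlgebraicGeometry MonoidalCategory CartesianMonoidalCategory
  Opposite

namespace Literature.AlgebraicGeometry.Motives

namespace SeesawSubscheme

open Literature.AlgebraicGeometry.Modules Literature.RingTheory.LocalSeesaw

variable (X : SchemeOver ℂ) {W : SchemeOver ℂ} (𝓕 : (X ⊗ W).left.Modules) (U : W.left.affineOpens)

variable [IsProper X.hom] [GeometricallyIntegral X.hom]


/-! ## §1 (T-H1′), dual side: a trivialised `B` has `Hom(𝓕_{B_g}|_⊤, 𝒪|_⊤) ≃ₗ[B_g] B_g` -/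

section GlobalFrameDual

variable {Y : Scheme.{0}} {E : Y.Modules} {I : Type} [Fintype I] [Unique I]

/-- **Dual sections of a module with a GLOBAL frame of rank one are the global functions**, linearly:
`μ ↦ μ(b)`, `c ↦ c · λ` (non-Prop plumbing). [folklore] -/
def dualSectionsEquivOfGlobalFrame (e : SheafOfModules.free I ≅ E.over (⊤ : Y.Opens)) :
    (E.over (⊤ : Y.Opens) ⟶ (unitModule Y).over (⊤ : Y.Opens)) ≃ₗ[Γ(Y, (⊤ : Y.Opens))] Γ(Y, (⊤ : Y.Opens)) where
  toFun μ := dualCoord e μ default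
  invFun c := c • dualBasis e default
  map_add' μ ν := by
    change appLE (μ + ν) (𝟙 ⊤) (basisSection e default) = _
    rw [appLE_add]; rfl
  map_smul' r μ := by
    change appLE (r • μ) (𝟙 ⊤) (basisSection e default) = _
    rw [appLE_smul, op_id, Y.presheaf.map_id]; rfl
  left_inv μ := by
    have h := eq_sum_smul_dualBasis e μ
    rw [Fintype.sum_unique] at h
    exact h.symm
  right_inv c := by
    change appLE (c • dualBasis e default) (𝟙 ⊤) (basisSection e default) = c
    rw [appLE_smul, op_id, Y.presheaf.map_id, ← coord_def, coord_basisSection, if_pos rfl]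
    change c * 1 = c
    rw [mul_one]

end GlobalFrameDual

omit [IsProper X.hom] [GeometricallyIntegral X.hom] in
/-- `Hom(𝓕_B|_⊤, 𝒪|_⊤) ≃ₗ[B] Γ(X_B, 𝒪)`-transport, as `h0LinearEquivOfSections` (non-Prop plumbing). [folklore] -/
def dualLinearEquivOfSections (B : Type) [CommRing B] [Algebra Γ(W.left, U) B]
    (ε : DualSec X 𝓕 U B ≃ₗ[Γ((X ⊗ specTest U B).left, (⊤ : (X ⊗ specTest U B).left.Opens))]
      Γ((X ⊗ specTest U B).left, (⊤ : (X ⊗ specTest U B).left.Opens)))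
    (τ : B ≃+* Γ((X ⊗ specTest U B).left, (⊤ : (X ⊗ specTest U B).left.Opens)))
    (hτ : ∀ b, τ b = toTopRing X U B b) : DualSec X 𝓕 U B ≃ₗ[B] B where
  toFun s := τ.symm (ε s)
  invFun c := ε.symm (τ c)
  map_add' s t := by rw [map_add, map_add]
  map_smul' c s := by
    rw [smul_DualSec_def, LinearEquiv.map_smul, smul_eq_mul, map_mul, RingHom.id_apply, smul_eq_mul, ← hτ,
      RingEquiv.symm_apply_apply]
  left_inv s := by
    change ε.symm (τ (τ.symm (ε s))) = s
    rw [RingEquiv.apply_symm_apply, LinearEquiv.symm_apply_apply]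
  right_inv c := by
    change τ.symm (ε (ε.symm (τ c))) = c
    rw [LinearEquiv.apply_symm_apply, RingEquiv.symm_apply_apply]

/-- **A global frame of rank one on `𝓕_B` gives `Hom(𝓕_B|_⊤, 𝒪|_⊤) ≃ₗ[B] B`.** [cite: MumfordAV1970, §10 (p. 89)] -/
theorem nonempty_dualSec_linearEquiv_of_globalFrame (B : Type) [CommRing B] [Algebra Γ(W.left, U) B]
    {I : Type} [Fintype I] [Unique I]
    (e₀ : SheafOfModules.free I ≅ (FB X 𝓕 U B).over (⊤ : (X ⊗ specTest U B).left.Opens)) :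
    Nonempty (DualSec X 𝓕 U B ≃ₗ[B] B) :=
  ⟨dualLinearEquivOfSections X 𝓕 U B (dualSectionsEquivOfGlobalFrame e₀)
    (RingEquiv.ofBijective (toTopRing X U B) (toTopRing_bijective X U B)) fun _ => rfl⟩

/-- **(T-H1′), dual side**: if `𝓕_B` is trivialised from the base then near every maximal ideal `𝔪` of
`B` there is `g ∉ 𝔪` with `Hom(𝓕_{B_g}|_⊤, 𝒪|_⊤) ≃ₗ[B_g] B_g`. [cite: MumfordAV1970, §10 (p. 89)] -/
theorem exists_dualSec_linearEquiv_of_triv (B : Type) [CommRing B] [Algebra Γ(W.left, U) B]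
    (hB : Triv X 𝓕 U B) (𝔪 : Ideal B) [𝔪.IsMaximal] :
    ∃ g ∉ 𝔪, Nonempty (DualSec X 𝓕 U (Localization.Away g) ≃ₗ[Localization.Away g] Localization.Away g) := by
  obtain ⟨𝓜, -, h𝓜1, ⟨e⟩⟩ := hB
  obtain ⟨F, hF⟩ := exists_frameSystem_of_hasRank h𝓜1
  let x : (specTest U B).left := (⟨𝔪, inferInstance⟩ : PrimeSpectrum B)
  obtain ⟨f, hfV, hxf⟩ :=
    (isAffineOpen_top (specTest U B).left).exists_basicOpen_le ⟨x, F.mem x⟩ (Set.mem_univ x)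
  have hfg : (specTest U B).left.basicOpen f =
      PrimeSpectrum.basicOpen ((Scheme.ΓSpecIso (.of B)).hom f) :=
    basicOpen_eq_of_affine' (R := .of B) f
  refine ⟨(Scheme.ΓSpecIso (.of B)).hom f, ?_, ?_⟩
  · have h : x ∈ (specTest U B).left.basicOpen f := hxf
    rw [hfg] at h
    exact h
  · haveI : Fintype (F.I x) := Fintype.ofEquiv _ ((F.enum x).trans (finCongr (hF x))).symm
    haveI : Unique (F.I x) := ((F.enum x).trans (finCongr (hF x))).unique
    exact nonempty_dualSec_linearEquiv_of_globalFrame X 𝓕 U (Localization.Away _)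
      (globalFrameAway (X := X) (𝓕 := 𝓕) _ e (F.frame x)
        (awayTestMap_preimage_eq_top _ fun p hp => hfV (hfg ▸ hp)))

/-! ## §2 THE CHART ASSEMBLY over the chart ring `A_f`: `Triv B ↔ (I ⊔ I′)·B = 0` -/

section ChartAway

variable (f : Γ(W.left, U))

/-- The `Γ(W, U)`-algebra structure on an `A_f`-algebra, by composition (non-Prop plumbing; used as a
local instance). [folklore] -/
@[reducible] def compAlgebra (B : Type) [CommRing B] [Algebra (Localization.Away f) B] :
    Algebra Γ(W.left, U) B :=
  ((algebraMap (Localization.Away f) B).comp (algebraMap Γ(W.left, U) (Localization.Away f))).toAlgebra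

omit [IsProper X.hom] [GeometricallyIntegral X.hom] in
/-- Under `compAlgebra`, `f` is invertible. [cite: MumfordAV1970, §10 (p. 89)] -/
theorem isUnit_algebraMap_compAlgebra (B : Type) [CommRing B] [Algebra (Localization.Away f) B] :
    letI := compAlgebra U f B
    IsUnit (algebraMap Γ(W.left, U) B f) := by
  letI := compAlgebra U f B
  change IsUnit ((algebraMap (Localization.Away f) B) (algebraMap Γ(W.left, U) (Localization.Away f) f))
  exact (IsLocalization.Away.algebraMap_isUnit f).map _

omit [IsProper X.hom] [GeometricallyIntegral X.hom] in
/-- Under `compAlgebra`, an ideal extended to `A_f` and then to `B` is the ideal extended to `B`. [cite: MumfordAV1970, §10 (p. 89)] -/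
theorem map_map_compAlgebra (I : Ideal Γ(W.left, U)) (B : Type) [CommRing B] [Algebra (Localization.Away f) B] :
    letI := compAlgebra U f B
    (I.map (algebraMap Γ(W.left, U) (Localization.Away f))).map (algebraMap (Localization.Away f) B) =
      I.map (algebraMap Γ(W.left, U) B) := by
  rw [Ideal.map_map]
  rfl

/-- For an `A_f`-algebra `B` and `g ∈ B`, `B_g` is an `A_f`-algebra and the two induced `Γ(W,U)`-algebra
structures on `B_g` agree. [cite: MumfordAV1970, §10 (p. 89)] -/
theorem compAlgebra_away_eq (B : Type) [CommRing B] [Algebra (Localization.Away f) B] (g : B) :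
    compAlgebra U f (Localization.Away g) =
      (letI := compAlgebra U f B; inferInstance : Algebra Γ(W.left, U) (Localization.Away g)) := by
  letI := compAlgebra U f B
  apply Algebra.algebra_ext
  intro r
  change ((algebraMap (Localization.Away f) (Localization.Away g)).comp
      (algebraMap Γ(W.left, U) (Localization.Away f))) r =
    (algebraMap B (Localization.Away g)) (((algebraMap (Localization.Away f) B).comp
      (algebraMap Γ(W.left, U) (Localization.Away f))) r)
  rw [RingHom.comp_apply, RingHom.comp_apply, IsScalarTower.algebraMap_apply (Localization.Away f) B
    (Localization.Away g)]

/-- **The local seesaw datum of the chart `(U, f)`** over `A_f = Localization.Away f`, from the guarded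
sockets `H0ReprChart`/`DualReprChart` and the bricks (A)(B)(N): its `Triv` is `Triv X 𝓕 U` on
`A_f`-algebras (viewed as `Γ(W,U)`-algebras by composition), its ideals are `I·A_f`, `I′·A_f`
(non-Prop plumbing). [cite: MumfordAV1970, §10 (p. 89)] -/
def chartDatumAway (h𝓕 : HasRank 𝓕 1) (hN : brickN X 𝓕 U h𝓕)
    {I I' : Ideal Γ(W.left, U)} (hρ : H0ReprChart X 𝓕 U f I) (hρ' : DualReprChart X 𝓕 U h𝓕 f I') :
    LocalSeesawDatum (Localization.Away f) where
  I := I.map (algebraMap Γ(W.left, U) (Localization.Away f))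
  I' := I'.map (algebraMap Γ(W.left, U) (Localization.Away f))
  Triv B _ _ := letI := compAlgebra U f B; Triv X 𝓕 U B
  annFree_of_triv B _ _ hB 𝔪 _ := by
    letI := compAlgebra U f B
    obtain ⟨g, hg, ⟨ε⟩⟩ := exists_h0_linearEquiv_of_triv X 𝓕 U B hB 𝔪
    obtain ⟨ρ, -⟩ := hρ
    have hfg : IsUnit (algebraMap Γ(W.left, U) (Localization.Away g) f) := by
      rw [IsScalarTower.algebraMap_apply Γ(W.left, U) B (Localization.Away g)]
      exact (isUnit_algebraMap_compAlgebra U f B).map _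
    refine ⟨g, hg, ⟨?_⟩⟩
    have hI : (I.map (algebraMap Γ(W.left, U) (Localization.Away f))).map
        (algebraMap (Localization.Away f) (Localization.Away g)) =
        I.map (algebraMap Γ(W.left, U) (Localization.Away g)) := by
      have h := map_map_compAlgebra U f I (Localization.Away g)
      rw [compAlgebra_away_eq U f B g] at h
      exact h
    rw [hI]
    exact (ρ (Localization.Away g) hfg).symm.trans ε
  annFree_of_triv' B _ _ hB 𝔪 _ := by
    letI := compAlgebra U f B
    obtain ⟨g, hg, ⟨ε⟩⟩ := exists_dualSec_linearEquiv_of_triv X 𝓕 U B hB 𝔪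
    obtain ⟨ρ', -⟩ := hρ'
    have hfg : IsUnit (algebraMap Γ(W.left, U) (Localization.Away g) f) := by
      rw [IsScalarTower.algebraMap_apply Γ(W.left, U) B (Localization.Away g)]
      exact (isUnit_algebraMap_compAlgebra U f B).map _
    refine ⟨g, hg, ⟨?_⟩⟩
    have hI : (I'.map (algebraMap Γ(W.left, U) (Localization.Away f))).map
        (algebraMap (Localization.Away f) (Localization.Away g)) =
        I'.map (algebraMap Γ(W.left, U) (Localization.Away g)) := by
      have h := map_map_compAlgebra U f I' (Localization.Away g)
      rw [compAlgebra_away_eq U f B g] at h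
      exact h
    rw [hI]
    exact (ρ' (Localization.Away g) hfg).symm.trans ε
  triv_of_map_eq_bot B _ _ hI hI' := by
    letI := compAlgebra U f B
    rw [map_map_compAlgebra] at hI hI'
    exact triv_of_map_eq_bot X 𝓕 U h𝓕 hN hρ hρ' B (isUnit_algebraMap_compAlgebra U f B) hI hI'

/-- **THE CHART THEOREM on `(U, f)`** ([MumfordAV1970] §10 p. 89 on one chart): if on the chart `(U, f)`
the functors `H⁰(𝓕)` and `Hom(𝓕, 𝒪)` are represented by `Ann(I)`, `Ann(I′)`, then for EVERY `A_f`-algebra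
`B`, `𝓕_B` is trivialised from the base iff `(I + I′)·B = 0` (hypothesis: the base-change identity (N)).
[cite: MumfordAV1970, §10 (p. 89)] [cite: GortzWedhorn2023, Thm. 24.66, proof (pp. 407–408)] -/
theorem triv_iff_chartAway (h𝓕 : HasRank 𝓕 1) (hN : brickN X 𝓕 U h𝓕)
    {I I' : Ideal Γ(W.left, U)} (hρ : H0ReprChart X 𝓕 U f I) (hρ' : DualReprChart X 𝓕 U h𝓕 f I')
    (B : Type) [CommRing B] [Algebra (Localization.Away f) B] :
    (letI := compAlgebra U f B; Triv X 𝓕 U B) ↔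
      ((I ⊔ I').map (algebraMap Γ(W.left, U) (Localization.Away f))).map
        (algebraMap (Localization.Away f) B) = ⊥ := by
  rw [Ideal.map_sup]
  exact (chartDatumAway X 𝓕 U f h𝓕 hN hρ hρ').triv_iff B

end ChartAway

end SeesawSubscheme

end Literature.AlgebraicGeometry.Motives

end
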